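import Summits.QuantumFields.BalabanUV.T4Continuum.Support.NE7K1LinFoldKernels
import Summits.QuantumFields.BalabanUV.T4Continuum.Support.NE7K1LinTwoRunKit

/-!
# NE7K1LinFoldMatrices — row NE7 (node U5), candidate route HOM, path H1L, cell K1-lin(s): THE THREE ENTRY-LEVEL INTERTWININGS
# OF I2 — the periodic fine operator folds onto Bałaban's Neumann `fineOpR`, block sums fold onto block sums
# (NEEDS-ESTIMATE #E1, input I2 — matrix half)

Lineage `b2b-balaban-t4-ne7-p2` (CRUX PROVER NE7 #2), generation 72; file 32 (matrix companion of files 30–31).  The abstract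
«LEMMA F» of file 30 (`NE7K1LinSchurFold.schurC_intertwine`) asks for three identities between a fine datum `(T, S, M)` and its
primed version: `M′E = EM`, `S′E = E_cS`, `ESᵀ = S′ᵀE_c`.  THIS FILE supplies them for Bałaban's `A = 0` operators:

* §1 the UNFOLD MATRIX `unfoldM N F G (x, y) = [fold_N x = y]` between a finite set `F` of torus representatives and a finite set
  `G` of box points (`unfoldM_mul_apply`: `(E·X)(x, ·) = X(fold x, ·)`), and the BLOCK-SUM MATRIX `bsum b R (β, x) = [blk_b x = β]`
  (`bsum_coordT`: `S·T(V,ψ) = L^{d+1}·V` — the tree's `blockSum_coordT`; `bsum_transpose_mul_bsum_apply` = the averaging kernel).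
* §2 `fineOpR_zero_apply` (entries of `fineOpR n a 0 R = n²(−Δ^N_R) + (a∕n^{d+1})·1[same n-block]`) and THE PERIODIC FINE
  OPERATOR `torOpK n a N F (x,y) = n²(2(d+1)[x = y] − tadj_N(x,y)) + (a∕n^{d+1})·1[same n-block]` on representatives
  `F = boxDom (dbl N)` — the same display with the periodised adjacency of file 31.
* §3 **`torOpK_mul_unfoldM`** — `M′E = EM`: `torOpK n a N 𝕋 · E = E · fineOpR n a 0 Π` for `Π = boxDom N`, `𝕋 = boxDom (dbl N)`,
  `N = n·K` (the `n`-blocks do not wrap): periodic folds to Neumann (`foldLap_eq`) and exactly one torus `n`-block over each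
  (block, image) pair (`card_fibre_blk`).
* §4 **`bsum_mul_unfoldM`** (`S′E = E_cS`) and **`unfoldM_mul_bsum_transpose`** (`ESᵀ = S′ᵀE_c`) at block scale `L` between
  `(𝕋, Π)` and their `L`-block labels `(𝕋.image (blk L), Π.image (blk L))` (`= boxDom (dbl N_c)`, `boxDom N_c`, `N = L·N_c`).

HONEST FRAMING: [folklore] finite bookkeeping; no estimate; nothing of Bałaban's asserted; no `sorry`.  Census only (I2's
matrix half); NE7 NOT PRINTED ∕ NOT PROVED; spine 0∕9; FIXED FINITE T⁴, rung (B)+1; NOT infinite volume, NOT mass gap, NOT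
Clay.  HONEST DEPENDENCY: continuum YM on T⁴ ⇐ BetaPertH ∧ nine spine estimates (0/9 proved); BetaPertH ⇐ (D1) ∧ (D4) ∧
CAP+tail; G-an2-4 gates asym, D1 and NE2/3/4.
-/

noncomputable section

open Finset Matrix

namespace Summit.QuantumFields.BalabanUV.T4Continuum.NE7K1LinFoldMatrices

open Literature.MathematicalPhysics.QuantumFieldTheory.Balaban1983to89
open Literature.MathematicalPhysics.QuantumFieldTheory.Balaban1983to89.B4Reflection242
open Literature.MathematicalPhysics.QuantumFieldTheory.Balaban1983to89.B4Lower18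
open NE7K1LinFoldKernels NE7K1LinBlockCoords NE7K1LinTwoRunKit

variable {d : ℕ}

/-! ### §1 The unfold matrix and the block-sum matrix -/

/-- the UNFOLD MATRIX `E(x, y) = [fold_N x = y]` (torus representatives `F` → box points `G`): `E·f = f ∘ fold`. [folklore] -/
def unfoldM (N : Fin (d + 1) → ℕ) (F G : Finset (Fin (d + 1) → ℤ)) : Matrix ↥F ↥G ℝ :=
  Matrix.of fun x y => if foldBox N x.1 = y.1 then 1 else 0

/-- unfolding lemma for `unfoldM`. [folklore] -/
@[simp] theorem unfoldM_apply (N : Fin (d + 1) → ℕ) (F G : Finset (Fin (d + 1) → ℤ)) (x : ↥F) (y : ↥G) :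
    unfoldM N F G x y = if foldBox N x.1 = y.1 then 1 else 0 := rfl

/-- `(E·X)(x, ·) = X(fold x, ·)` when `fold x ∈ G`. [folklore] -/
theorem unfoldM_mul_apply {N : Fin (d + 1) → ℕ} {F G : Finset (Fin (d + 1) → ℤ)} {κ : Type*} (X : Matrix ↥G κ ℝ) (x : ↥F)
    (h : foldBox N x.1 ∈ G) (z : κ) : (unfoldM N F G * X) x z = X ⟨foldBox N x.1, h⟩ z := by
  classical
  rw [Matrix.mul_apply, Finset.sum_eq_single ⟨foldBox N x.1, h⟩]
  · simp
  · intro y _ hy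
    have : foldBox N x.1 ≠ y.1 := fun e => hy (Subtype.ext e.symm)
    simp [this]
  · intro hh; exact absurd (Finset.mem_univ _) hh

/-- the BLOCK-SUM MATRIX `S(β, x) = [blk_b x = β]` of a region: `(S·φ)(β) = Σ_{x ∈ block β} φ(x)`. [folklore] -/
def bsum (b : ℕ) (R : Finset (Fin (d + 1) → ℤ)) : Matrix ↥(R.image (blk b)) ↥R ℝ :=
  Matrix.of fun β x => if rblk b R x = β then 1 else 0

/-- unfolding lemma for `bsum`. [folklore] -/
@[simp] theorem bsum_apply (b : ℕ) (R : Finset (Fin (d + 1) → ℤ)) (β : ↥(R.image (blk b))) (x : ↥R) :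
    bsum b R β x = if rblk b R x = β then 1 else 0 := rfl

/-- block sums as filtered sums. [folklore] -/
theorem bsum_mulVec {b : ℕ} {R : Finset (Fin (d + 1) → ℤ)} (w : ↥R → ℝ) (β : ↥(R.image (blk b))) :
    (bsum b R *ᵥ w) β = ∑ x ∈ Finset.univ.filter (fun x => rblk b R x = β), w x := by
  simp only [Matrix.mulVec, dotProduct, bsum_apply, ite_mul, one_mul, zero_mul, Finset.sum_filter]

/-- **THE READ-OUT IDENTITY `S·T(V,ψ) = L^{d+1}·V`** (the tree's `blockSum_coordT`). [folklore] -/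
theorem bsum_coordT {L : ℕ} [NeZero L] {R' : Finset (Fin (d + 1) → ℤ)} (hR'L : IsBlockUnion L R')
    (u : ↥(R'.image (blk L)) ⊕ (↥(R'.image (blk L)) × NZ d L) → ℝ) :
    bsum L R' *ᵥ (coordT hR'L *ᵥ u) = fun β => (L : ℝ) ^ (d + 1) * u (Sum.inl β) := by
  ext β
  rw [bsum_mulVec]
  exact blockSum_coordT hR'L u β

/-- `SᵀS` is the same-block indicator (B4's `Q*Q` up to normalisation). [folklore] -/
theorem bsum_transpose_mul_bsum_apply (b : ℕ) (R : Finset (Fin (d + 1) → ℤ)) (x y : ↥R) :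
    ((bsum b R)ᵀ * bsum b R) x y = if blk b y.1 = blk b x.1 then 1 else 0 := by
  classical
  rw [Matrix.mul_apply, Finset.sum_eq_single (rblk b R x)]
  · simp only [Matrix.transpose_apply, bsum_apply, if_true, one_mul]
    have : (rblk b R y = rblk b R x) ↔ (blk b y.1 = blk b x.1) := by simp [rblk, Subtype.ext_iff]
    simp only [this]
  · intro β _ hβ
    simp [Matrix.transpose_apply, Ne.symm hβ]
  · intro h; exact absurd (Finset.mem_univ _) h

/-! ### §2 Entries of Bałaban's `fineOpR` at `A = 0`, and the periodic fine operator on representatives -/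

/-- entries of `fineOpR n a 0 R = n²(−Δ^N_R) + (a∕n^{d+1})·1[same n-block]`. [folklore] -/
theorem fineOpR_zero_apply (n : ℕ) (a : ℝ) (R : Finset (Fin (d + 1) → ℤ)) (x y : ↥R) :
    fineOpR n a 0 R x y = (n : ℝ) ^ 2 * neumannLapR R x.1 y.1 +
      (if blk n y.1 = blk n x.1 then a * ((n : ℝ) ^ (d + 1))⁻¹ else 0) := by
  simp only [fineOpR, regionOpR, Matrix.of_apply, diagK, avgK]
  split_ifs <;> ring

/-- **THE PERIODIC FINE OPERATOR ON REPRESENTATIVES**: `n²·(2(d+1)[x = y] − tadj_N(x, y)) + (a∕n^{d+1})·1[same n-block]` — the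
operator `n²(−Δ^{per}) + (a∕n^{d+1})·1[same n-block]` of the torus `Π_μ ℤ∕2N_μ`, typed on any finite set `F` of lattice points
(meant: `F = boxDom (dbl N)`). [folklore] -/
def torOpK (n : ℕ) (a : ℝ) (N : Fin (d + 1) → ℕ) (F : Finset (Fin (d + 1) → ℤ)) : Matrix ↥F ↥F ℝ :=
  Matrix.of fun x y => (n : ℝ) ^ 2 * ((if x = y then 2 * ((d : ℝ) + 1) else 0) - (tadj N x.1 y.1 : ℝ)) +
    (if blk n y.1 = blk n x.1 then a * ((n : ℝ) ^ (d + 1))⁻¹ else 0)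

/-- unfolding lemma for `torOpK`. [folklore] -/
theorem torOpK_apply (n : ℕ) (a : ℝ) (N : Fin (d + 1) → ℕ) (F : Finset (Fin (d + 1) → ℤ)) (x y : ↥F) :
    torOpK n a N F x y = (n : ℝ) ^ 2 * ((if x = y then 2 * ((d : ℝ) + 1) else 0) - (tadj N x.1 y.1 : ℝ)) +
      (if blk n y.1 = blk n x.1 then a * ((n : ℝ) ^ (d + 1))⁻¹ else 0) := rfl

/-- `torOpK` is a symmetric matrix on representatives. [folklore] -/
theorem torOpK_isSymm (n : ℕ) (a : ℝ) (N : Fin (d + 1) → ℕ) {F : Finset (Fin (d + 1) → ℤ)} (hF : F = boxDom (dbl N)) :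
    (torOpK n a N F).IsSymm := by
  subst hF
  ext x y
  simp only [Matrix.transpose_apply, torOpK_apply]
  rw [tadj_comm y.2 x.2, eq_comm]
  by_cases h : x = y
  · subst h; simp
  · rw [if_neg h, if_neg (Ne.symm h)]
    by_cases hb : blk n x.1 = blk n y.1
    · rw [if_pos hb, if_pos hb.symm]
    · rw [if_neg hb, if_neg (Ne.symm hb)]

/-! ### §3 `M′E = EM`: the periodic fine operator folds onto the Neumann fine operator -/

/-- positivity of the refined side lengths. [folklore] -/
theorem mul_pos_side {n : ℕ} (hn : 1 ≤ n) {K : Fin (d + 1) → ℕ} (hK : ∀ i, 1 ≤ K i) : ∀ i, 1 ≤ (fun i => n * K i) i :=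
  fun i => Nat.one_le_iff_ne_zero.2 (Nat.mul_ne_zero (by omega) (by have := hK i; omega))

/-- a representative of the fine torus `boxDom (dbl (n·K))` has its `n`-block label in the coarse torus `boxDom (dbl K)`.
[folklore] -/
theorem blk_mem_dbl {n : ℕ} (hn : 1 ≤ n) {K : Fin (d + 1) → ℕ} {x : Fin (d + 1) → ℤ}
    (hx : x ∈ boxDom (dbl fun i => n * K i)) : blk n x ∈ boxDom (dbl K) := by
  rw [dbl_mul, mem_boxDom_mul_iff hn] at hx
  exact hx

/-- indicator sums over a finite set of lattice points, as a subtype sum. [folklore] -/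
theorem sum_coe_ite {F : Finset (Fin (d + 1) → ℤ)} (p : (Fin (d + 1) → ℤ) → Prop) [DecidablePred p] (c : ℝ) :
    ∑ l : ↥F, (if p l.1 then c else 0) = c * ((F.filter p).card : ℝ) := by
  rw [Finset.sum_coe_sort F (fun l => if p l then c else 0), ← Finset.sum_filter, Finset.sum_const, nsmul_eq_mul, mul_comm]

/-- **`M′E = EM` — THE PERIODIC FINE OPERATOR FOLDS ONTO BAŁABAN's NEUMANN `fineOpR`**: for `Π = boxDom (n·K)`,
`𝕋 = boxDom (dbl (n·K))` and every `a`, `torOpK n a (n·K) 𝕋 · E = E · fineOpR n a 0 Π`. [folklore] -/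
theorem torOpK_mul_unfoldM {n : ℕ} (hn : 1 ≤ n) (a : ℝ) {K : Fin (d + 1) → ℕ} (hK : ∀ i, 1 ≤ K i)
    {F G : Finset (Fin (d + 1) → ℤ)} (hF : F = boxDom (dbl fun i => n * K i)) (hG : G = boxDom fun i => n * K i) :
    torOpK n a (fun i => n * K i) F * unfoldM (fun i => n * K i) F G =
      unfoldM (fun i => n * K i) F G * fineOpR n a 0 G := by
  classical
  subst hF hG
  have hN : ∀ i, 1 ≤ (fun i => n * K i) i := mul_pos_side hn hK
  ext x y
  have hfx : foldBox (fun i => n * K i) x.1 ∈ boxDom (fun i => n * K i) := foldBox_mem_boxDom hN x.1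
  rw [unfoldM_mul_apply _ x hfx, fineOpR_zero_apply, Matrix.mul_apply]
  simp only [torOpK_apply, unfoldM_apply]
  -- the three sums
  have hA : ∑ l : ↥(boxDom (dbl fun i => n * K i)),
      (if x = l then (if foldBox (fun i => n * K i) l.1 = y.1 then (1 : ℝ) else 0) else 0) =
      if foldBox (fun i => n * K i) x.1 = y.1 then (1 : ℝ) else 0 := by
    rw [Finset.sum_ite_eq, if_pos (Finset.mem_univ _)]
  have hB : ∑ l : ↥(boxDom (dbl fun i => n * K i)),
      (tadj (fun i => n * K i) x.1 l.1 : ℝ) * (if foldBox (fun i => n * K i) l.1 = y.1 then (1 : ℝ) else 0) =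
      (((nbrs x.1).filter fun z => foldBox (fun i => n * K i) z = y.1).card : ℝ) :=
    (Finset.sum_coe_sort (boxDom (dbl fun i => n * K i))
      (fun l => (tadj (fun i => n * K i) x.1 l : ℝ) * (if foldBox (fun i => n * K i) l = y.1 then (1 : ℝ) else 0))).trans
      (sum_tadj_indicator hN x.1 y.1)
  have hC : ∑ l : ↥(boxDom (dbl fun i => n * K i)),
      (if (blk n l.1 = blk n x.1 ∧ foldBox (fun i => n * K i) l.1 = y.1) then a * ((n : ℝ) ^ (d + 1))⁻¹ else 0) =
      a * ((n : ℝ) ^ (d + 1))⁻¹ * (if foldBox K (blk n x.1) = blk n y.1 then (1 : ℝ) else 0) := by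
    have h := sum_coe_ite (F := boxDom (dbl fun i => n * K i))
      (fun z => blk n z = blk n x.1 ∧ foldBox (fun i => n * K i) z = y.1) (a * ((n : ℝ) ^ (d + 1))⁻¹)
    rw [card_fibre_blk hn hK (blk_mem_dbl hn x.2) y.2, Nat.cast_ite, Nat.cast_one, Nat.cast_zero] at h
    exact h
  -- expand the summand into the three pieces
  have e1 : ∀ l : ↥(boxDom (dbl fun i => n * K i)),
      ((n : ℝ) ^ 2 * ((if x = l then 2 * ((d : ℝ) + 1) else 0) - (tadj (fun i => n * K i) x.1 l.1 : ℝ)) +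
          (if blk n l.1 = blk n x.1 then a * ((n : ℝ) ^ (d + 1))⁻¹ else 0)) *
        (if foldBox (fun i => n * K i) l.1 = y.1 then (1 : ℝ) else 0) =
      (n : ℝ) ^ 2 * (2 * ((d : ℝ) + 1)) *
          (if x = l then (if foldBox (fun i => n * K i) l.1 = y.1 then (1 : ℝ) else 0) else 0) -
        (n : ℝ) ^ 2 * ((tadj (fun i => n * K i) x.1 l.1 : ℝ) * (if foldBox (fun i => n * K i) l.1 = y.1 then (1 : ℝ) else 0)) +
        (if (blk n l.1 = blk n x.1 ∧ foldBox (fun i => n * K i) l.1 = y.1) then a * ((n : ℝ) ^ (d + 1))⁻¹ else 0) := by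
    intro l
    by_cases h1 : x = l <;> by_cases h2 : foldBox (fun i => n * K i) l.1 = y.1 <;>
      by_cases h3 : blk n l.1 = blk n x.1 <;> simp [h1, h2, h3, mul_sub]
  rw [Finset.sum_congr rfl fun l _ => e1 l, Finset.sum_add_distrib, Finset.sum_sub_distrib, ← Finset.mul_sum,
    ← Finset.mul_sum, hA, hB, hC, ← foldLap_eq hN x.1 y.2, blk_foldBox hn hK]
  by_cases hfold : foldBox K (blk n x.1) = blk n y.1
  · rw [if_pos hfold, if_pos hfold.symm]; ring
  · rw [if_neg hfold, if_neg (Ne.symm hfold)]; ring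

/-! ### §4 `S′E = E_cS` and `ESᵀ = S′ᵀE_c`: block sums fold onto block sums -/

/-- the `L`-block labels of the fine torus representatives are the coarse torus representatives. [folklore] -/
theorem image_blk_dbl {L : ℕ} (hL : 1 ≤ L) (Nc : Fin (d + 1) → ℕ) :
    (boxDom (dbl fun i => L * Nc i)).image (blk L) = boxDom (dbl Nc) := by
  rw [dbl_mul, image_blk_boxDom hL]

/-- **`S′E = E_cS` — ONE TORUS BLOCK OVER EACH (BLOCK, IMAGE) PAIR**: `bsum L 𝕋 · E_N = E_{N_c} · bsum L Π` (`N = L·N_c`).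
[folklore] -/
theorem bsum_mul_unfoldM {L : ℕ} (hL : 1 ≤ L) {Nc : Fin (d + 1) → ℕ} (hNc : ∀ i, 1 ≤ Nc i)
    {F G : Finset (Fin (d + 1) → ℤ)} (hF : F = boxDom (dbl fun i => L * Nc i)) (hG : G = boxDom fun i => L * Nc i) :
    bsum L F * unfoldM (fun i => L * Nc i) F G = unfoldM Nc (F.image (blk L)) (G.image (blk L)) * bsum L G := by
  classical
  subst hF hG
  ext β' y
  rw [Matrix.mul_apply, Matrix.mul_apply]
  -- right side: the single term `β = rblk y`
  rw [Finset.sum_eq_single (rblk L _ y)]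
  · simp only [bsum_apply, unfoldM_apply, if_true, mul_one]
    -- left side: a fibre count
    have e1 : ∀ x' : ↥(boxDom (dbl fun i => L * Nc i)),
        (if rblk L _ x' = β' then (1 : ℝ) else 0) * (if foldBox (fun i => L * Nc i) x'.1 = y.1 then (1 : ℝ) else 0) =
          if (blk L x'.1 = β'.1 ∧ foldBox (fun i => L * Nc i) x'.1 = y.1) then 1 else 0 := by
      intro x'
      have : (rblk L _ x' = β') ↔ blk L x'.1 = β'.1 := by simp [rblk, Subtype.ext_iff]
      by_cases h1 : blk L x'.1 = β'.1 <;> by_cases h2 : foldBox (fun i => L * Nc i) x'.1 = y.1 <;> simp [this, h1, h2]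
    have hβ' : β'.1 ∈ boxDom (dbl Nc) := by rw [← image_blk_dbl hL Nc]; exact β'.2
    have h := sum_coe_ite (F := boxDom (dbl fun i => L * Nc i))
      (fun z => blk L z = β'.1 ∧ foldBox (fun i => L * Nc i) z = y.1) (1 : ℝ)
    rw [card_fibre_blk hL hNc hβ' y.2, Nat.cast_ite, Nat.cast_one, Nat.cast_zero, one_mul] at h
    rw [Finset.sum_congr rfl fun x' _ => e1 x']
    refine h.trans ?_
    have : (rblk L (boxDom fun i => L * Nc i) y).1 = blk L y.1 := rfl
    rw [this]
  · intro β _ hβ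
    simp [Ne.symm hβ]
  · intro h; exact absurd (Finset.mem_univ _) h

/-- **`ESᵀ = S′ᵀE_c` — BLOCK-CONSTANT EXTENSION COMMUTES WITH UNFOLDING**: `E_N · (bsum L Π)ᵀ = (bsum L 𝕋)ᵀ · E_{N_c}`.
[folklore] -/
theorem unfoldM_mul_bsum_transpose {L : ℕ} (hL : 1 ≤ L) {Nc : Fin (d + 1) → ℕ} (hNc : ∀ i, 1 ≤ Nc i)
    {F G : Finset (Fin (d + 1) → ℤ)} (hF : F = boxDom (dbl fun i => L * Nc i)) (hG : G = boxDom fun i => L * Nc i) :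
    unfoldM (fun i => L * Nc i) F G * (bsum L G)ᵀ = (bsum L F)ᵀ * unfoldM Nc (F.image (blk L)) (G.image (blk L)) := by
  classical
  subst hF hG
  have hN : ∀ i, 1 ≤ (fun i => L * Nc i) i := mul_pos_side hL hNc
  ext x' β
  have hfx : foldBox (fun i => L * Nc i) x'.1 ∈ boxDom (fun i => L * Nc i) := foldBox_mem_boxDom hN x'.1
  rw [unfoldM_mul_apply _ x' hfx, Matrix.transpose_apply, bsum_apply, Matrix.mul_apply,
    Finset.sum_eq_single (rblk L _ x')]
  · simp only [Matrix.transpose_apply, bsum_apply, if_true, one_mul, unfoldM_apply]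
    have e1 : (rblk L (boxDom fun i => L * Nc i) ⟨foldBox (fun i => L * Nc i) x'.1, hfx⟩ = β) ↔
        blk L (foldBox (fun i => L * Nc i) x'.1) = β.1 := by simp [rblk, Subtype.ext_iff]
    have e2 : (rblk L (boxDom (dbl fun i => L * Nc i)) x').1 = blk L x'.1 := rfl
    simp only [e1, e2, blk_foldBox hL hNc]
  · intro β'' _ hβ''
    simp [Matrix.transpose_apply, Ne.symm hβ'']
  · intro h; exact absurd (Finset.mem_univ _) h

end Summit.QuantumFields.BalabanUV.T4Continuum.NE7K1LinFoldMatrices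

end
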